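import Mathlib
import HarnessLib

/-!
# The principal Frobenius solution of the prolate equation at the singular point `x = λ`

THIS IS NOT AN RH STATEMENT.  For `λ > 0` and a parameter `χ ∈ ℝ` we construct the solution
`u = frobSol λ χ` of the prolate differential equation

  `(λ² − x²) u″(x) − 2x u′(x) + (χ − (2πλx)²) u(x) = 0`,  i.e.  `−((λ² − x²) u′)′ + (2πλx)² u = χ u`,

which is REGULAR (indeed analytic) at the regular-singular point `x = λ` and normalised by
`u(λ) = 1`: the Frobenius exponents at `x = λ` are `0, 0`, so there is exactly one power-series
solution `u(x) = Σ_k a_k (λ − x)^k`, `a₀ = 1`, and its radius of convergence is `2λ` (the distance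
to the other singular point `x = −λ`).  Substituting `t = λ − x` the equation becomes
`t(2λ − t) w″ + 2(λ − t) w′ + (χ − 4π²λ²(λ − t)²) w = 0`, whose coefficients satisfy the four-term
recursion (`frobCoeff_rec`)

  `2λ(k+1)² a_{k+1} = (k(k+1) − χ + 4π²λ⁴) a_k − 8π²λ³ a_{k−1} + 4π²λ² a_{k−2}`,  `a₀ = 1`.

Main results (all for `|λ − x| < 2λ`, i.e. `x ∈ (−λ, 3λ)`):
* `frobCoeff_bound`: `|a_k(χ)| ρ₀^k ≤ C(M, λ, ρ₀)` for `ρ₀ < 2λ`, uniformly in `|χ| ≤ M`;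
* `hasDerivAt_frobSol`, `hasDerivAt_frobSol₁`, `differentiableAt_frobSol₂`: term-wise derivatives;
* `frobSol_ode`: the equation, `frobSol_eigen`: its divergence form, `frobSol_self : u(λ) = 1`,
  `frobSol₁_self : u′(λ) = (χ − 4π²λ⁴)/(2λ)`;
* `contDiffOn_frobSol`: `u` is `C²` on `(−λ, 3λ)`;
* `continuousOn_frobSol_uncurry` (and `…frobSol₁…`): joint continuity in `(χ, x)`.

This is the existence half of the classical construction of the prolate spheroidal wave functions;
the method is the Frobenius method at a regular singular point with equal exponents.
References: [Coddington–Levinson 1955, Ch. 4 §8]; [Hartman 2002, Ch. IV §§10–11]; the prolate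
equation [Slepian–Pollak 1961, §III eq. (11)]; [Connes–Consani–Moscovici 2025, §7 eq. (7.5)].
-/

noncomputable section

open Real Set Filter Topology

namespace Literature.NumberTheory.LFunctions

variable {lam χ : ℝ}

/-! ### The Frobenius coefficients -/

/-- The coefficient triples `(a_{k−2}, a_{k−1}, a_k)` of the Frobenius series at `x = λ`
(`a_{−1} = a_{−2} = 0`, `a₀ = 1`), defined by the four-term recursion of the prolate equation.
[cite: CoddingtonLevinson1955, Ch. 4 §8] -/
def frobTriple (lam χ : ℝ) : ℕ → ℝ × ℝ × ℝ
  | 0 => (0, 0, 1)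
  | k + 1 =>
    ((frobTriple lam χ k).2.1, (frobTriple lam χ k).2.2,
      ((((k : ℝ) * ((k : ℝ) + 1) - χ + 4 * π ^ 2 * lam ^ 4) * (frobTriple lam χ k).2.2
        - 8 * π ^ 2 * lam ^ 3 * (frobTriple lam χ k).2.1
        + 4 * π ^ 2 * lam ^ 2 * (frobTriple lam χ k).1) / (2 * lam * ((k : ℝ) + 1) ^ 2)))

/-- The Frobenius coefficient `a_k(χ)` of `u(x) = Σ a_k (λ − x)^k`.
[cite: CoddingtonLevinson1955, Ch. 4 §8] -/
def frobCoeff (lam χ : ℝ) (k : ℕ) : ℝ := (frobTriple lam χ k).2.2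

/-- `a_{k−1}` (with `a_{−1} = 0`). [cite: CoddingtonLevinson1955, Ch. 4 §8] -/
def frobPrev (lam χ : ℝ) (k : ℕ) : ℝ := (frobTriple lam χ k).2.1

/-- `a_{k−2}` (with `a_{−1} = a_{−2} = 0`). [cite: CoddingtonLevinson1955, Ch. 4 §8] -/
def frobPrev₂ (lam χ : ℝ) (k : ℕ) : ℝ := (frobTriple lam χ k).1

/-- `a₀ = 1`. [cite: CoddingtonLevinson1955, Ch. 4 §8] -/
@[simp] theorem frobCoeff_zero : frobCoeff lam χ 0 = 1 := rfl

/-- `a_{−1} = 0`. [cite: CoddingtonLevinson1955, Ch. 4 §8] -/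
@[simp] theorem frobPrev_zero : frobPrev lam χ 0 = 0 := rfl

/-- `a_{−2} = 0`. [cite: CoddingtonLevinson1955, Ch. 4 §8] -/
@[simp] theorem frobPrev₂_zero : frobPrev₂ lam χ 0 = 0 := rfl

/-- Shift of the first auxiliary sequence. [cite: CoddingtonLevinson1955, Ch. 4 §8] -/
@[simp] theorem frobPrev_succ (k : ℕ) : frobPrev lam χ (k + 1) = frobCoeff lam χ k := rfl

/-- Shift of the second auxiliary sequence. [cite: CoddingtonLevinson1955, Ch. 4 §8] -/
@[simp] theorem frobPrev₂_succ (k : ℕ) : frobPrev₂ lam χ (k + 1) = frobPrev lam χ k := rfl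

/-- The recursion, solved for `a_{k+1}`. [cite: CoddingtonLevinson1955, Ch. 4 §8] -/
theorem frobCoeff_succ (k : ℕ) : frobCoeff lam χ (k + 1) =
    ((((k : ℝ) * ((k : ℝ) + 1) - χ + 4 * π ^ 2 * lam ^ 4) * frobCoeff lam χ k
      - 8 * π ^ 2 * lam ^ 3 * frobPrev lam χ k + 4 * π ^ 2 * lam ^ 2 * frobPrev₂ lam χ k)
      / (2 * lam * ((k : ℝ) + 1) ^ 2)) := rfl

/-- `a₁ = (4π²λ⁴ − χ)/(2λ)`. [cite: CoddingtonLevinson1955, Ch. 4 §8] -/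
theorem frobCoeff_one (lam χ : ℝ) : frobCoeff lam χ 1 = (4 * π ^ 2 * lam ^ 4 - χ) / (2 * lam) := by
  change frobCoeff lam χ (0 + 1) = _
  rw [frobCoeff_succ]
  simp only [Nat.cast_zero, zero_add, zero_sub, frobCoeff_zero, mul_one, frobPrev_zero,
    frobPrev₂_zero, mul_zero, sub_zero, add_zero, one_pow]
  ring

/-- **The four-term recursion** `2λ(k+1)² a_{k+1} = (k(k+1) − χ + 4π²λ⁴) a_k − 8π²λ³ a_{k−1} + 4π²λ² a_{k−2}`
of the Frobenius coefficients of the prolate equation at `x = λ`.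
[cite: CoddingtonLevinson1955, Ch. 4 §8; SlepianPollak1961, §III eq. (11)] -/
theorem frobCoeff_rec (hlam : lam ≠ 0) (k : ℕ) :
    2 * lam * ((k : ℝ) + 1) ^ 2 * frobCoeff lam χ (k + 1) =
      ((k : ℝ) * ((k : ℝ) + 1) - χ + 4 * π ^ 2 * lam ^ 4) * frobCoeff lam χ k
        - 8 * π ^ 2 * lam ^ 3 * frobPrev lam χ k + 4 * π ^ 2 * lam ^ 2 * frobPrev₂ lam χ k := by
  rw [frobCoeff_succ]
  have : (2 * lam * ((k : ℝ) + 1) ^ 2) ≠ 0 := by positivity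
  exact mul_div_cancel₀ _ this

/-- The coefficients depend continuously (indeed polynomially) on `χ`.
[cite: CoddingtonLevinson1955, Ch. 4 §8] -/
theorem continuous_frobTriple (lam : ℝ) (k : ℕ) : Continuous fun χ ↦ frobTriple lam χ k := by
  induction k with
  | zero => simp only [frobTriple]; exact continuous_const
  | succ k ih =>
    have h1 : Continuous fun χ ↦ (frobTriple lam χ k).1 := continuous_fst.comp ih
    have h21 : Continuous fun χ ↦ (frobTriple lam χ k).2.1 :=
      continuous_fst.comp (continuous_snd.comp ih)
    have h22 : Continuous fun χ ↦ (frobTriple lam χ k).2.2 :=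
      continuous_snd.comp (continuous_snd.comp ih)
    simp only [frobTriple]
    refine h21.prodMk (h22.prodMk ?_)
    refine Continuous.div_const ?_ _
    exact ((((continuous_const.sub continuous_id).add continuous_const).mul h22).sub
      (continuous_const.mul h21)).add (continuous_const.mul h1)

/-- `χ ↦ a_k(χ)` is continuous. [cite: CoddingtonLevinson1955, Ch. 4 §8] -/
theorem continuous_frobCoeff (lam : ℝ) (k : ℕ) : Continuous fun χ ↦ frobCoeff lam χ k :=
  continuous_snd.comp (continuous_snd.comp (continuous_frobTriple lam k))

/-! ### The coefficient bound: radius of convergence `2λ` -/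

/-- **Cauchy-type bound for the Frobenius coefficients.**  For `0 ≤ ρ₀ < 2λ` and `M ≥ |χ|`:
`|a_k(χ)| ρ₀^k ≤ C` with `C` depending only on `M, λ, ρ₀` (so the series has radius `≥ 2λ`, uniformly
in `χ` on bounded sets).  Proof: the recursion gives `|a_{k+1}|ρ₀^{k+1} ≤ θ_k ·` (the largest of the
three previous weighted coefficients) with `θ_k → ρ₀/(2λ) < 1`.
[cite: CoddingtonLevinson1955, Ch. 4 §8 (convergence proof)] -/
theorem frobCoeff_bound (hlam : 0 < lam) {ρ₀ : ℝ} (hρ₀ : 0 ≤ ρ₀) (hρ : ρ₀ < 2 * lam) (M : ℝ) :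
    ∃ C : ℝ, 0 < C ∧ ∀ χ : ℝ, |χ| ≤ M → ∀ k : ℕ, |frobCoeff lam χ k| * ρ₀ ^ k ≤ C := by
  set E : ℝ := |M| + 4 * π ^ 2 * lam ^ 4 + 8 * π ^ 2 * lam ^ 3 * ρ₀ + 4 * π ^ 2 * lam ^ 2 * ρ₀ ^ 2
    with hE
  have hE0 : 0 ≤ E := by positivity
  set Θ : ℝ := max 1 (ρ₀ * (1 + E) / (2 * lam)) with hΘ
  have hΘ1 : 1 ≤ Θ := le_max_left _ _
  set K₀ : ℕ := ⌈ρ₀ * E / (2 * lam - ρ₀)⌉₊ with hK₀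
  have h2l : 0 < 2 * lam - ρ₀ := by linarith
  -- the contraction factors
  have hθ₁ : ∀ k : ℕ, ((k : ℝ) * ((k : ℝ) + 1) + E) * ρ₀ / (2 * lam * ((k : ℝ) + 1) ^ 2) ≤ Θ := by
    intro k
    refine le_trans ?_ (le_max_right _ _)
    rw [div_le_div_iff₀ (by positivity) (by positivity)]
    have hk0 : (0 : ℝ) ≤ k := Nat.cast_nonneg k
    have hk : (k : ℝ) * ((k : ℝ) + 1) + E ≤ (1 + E) * ((k : ℝ) + 1) ^ 2 := by
      have e : (1 + E) * ((k : ℝ) + 1) ^ 2 - ((k : ℝ) * ((k : ℝ) + 1) + E)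
          = ((k : ℝ) + 1) + E * ((k : ℝ) ^ 2 + 2 * (k : ℝ)) := by ring
      have : 0 ≤ ((k : ℝ) + 1) + E * ((k : ℝ) ^ 2 + 2 * (k : ℝ)) := by positivity
      linarith
    calc ((k : ℝ) * ((k : ℝ) + 1) + E) * ρ₀ * (2 * lam)
        ≤ (1 + E) * ((k : ℝ) + 1) ^ 2 * ρ₀ * (2 * lam) := by gcongr
      _ = ρ₀ * (1 + E) * (2 * lam * ((k : ℝ) + 1) ^ 2) := by ring
  have hθ₂ : ∀ k : ℕ, K₀ ≤ k →
      ((k : ℝ) * ((k : ℝ) + 1) + E) * ρ₀ / (2 * lam * ((k : ℝ) + 1) ^ 2) ≤ 1 := by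
    intro k hk
    rw [div_le_one (by positivity)]
    have hk' : ρ₀ * E / (2 * lam - ρ₀) ≤ k := le_trans (Nat.le_ceil _) (by exact_mod_cast hk)
    rw [div_le_iff₀ h2l] at hk'
    have hk0 : (0 : ℝ) ≤ k := Nat.cast_nonneg k
    have hk2 : 0 ≤ (2 * lam - ρ₀) * (k : ℝ) ^ 2 + 2 * lam * (k : ℝ) + 2 * lam := by positivity
    have e : 2 * lam * ((k : ℝ) + 1) ^ 2 - ((k : ℝ) * ((k : ℝ) + 1) + E) * ρ₀
        = ((2 * lam - ρ₀) * (k : ℝ) ^ 2 + 2 * lam * (k : ℝ) + 2 * lam)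
          + ((k : ℝ) * (2 * lam - ρ₀) - ρ₀ * E) := by ring
    linarith
  refine ⟨Θ ^ K₀, by positivity, fun χ hχ ↦ ?_⟩
  have hχM : |χ| ≤ |M| := hχ.trans (le_abs_self M)
  -- invariant of the triple
  have key : ∀ k : ℕ, |frobCoeff lam χ k| * ρ₀ ^ k ≤ Θ ^ min k K₀ ∧
      |frobPrev lam χ k| * ρ₀ ^ k ≤ ρ₀ * Θ ^ min k K₀ ∧
      |frobPrev₂ lam χ k| * ρ₀ ^ k ≤ ρ₀ ^ 2 * Θ ^ min k K₀ := by
    intro k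
    induction k with
    | zero =>
      refine ⟨?_, ?_, ?_⟩
      · simp
      · simpa using hρ₀
      · simpa using sq_nonneg ρ₀
    | succ k ih =>
      obtain ⟨h0, h1, h2⟩ := ih
      set P : ℝ := Θ ^ min k K₀ with hP
      have hP0 : 0 ≤ P := by positivity
      have hmono : P ≤ Θ ^ min (k + 1) K₀ :=
        pow_le_pow_right₀ hΘ1 (min_le_min_right _ (Nat.le_succ k))
      refine ⟨?_, ?_, ?_⟩
      · -- the new coefficient
        have hden : 0 < 2 * lam * ((k : ℝ) + 1) ^ 2 := by positivity
        have hnum : |((k : ℝ) * ((k : ℝ) + 1) - χ + 4 * π ^ 2 * lam ^ 4) * frobCoeff lam χ k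
            - 8 * π ^ 2 * lam ^ 3 * frobPrev lam χ k + 4 * π ^ 2 * lam ^ 2 * frobPrev₂ lam χ k|
              * ρ₀ ^ k ≤ ((k : ℝ) * ((k : ℝ) + 1) + E) * P := by
          have hc : |(k : ℝ) * ((k : ℝ) + 1) - χ + 4 * π ^ 2 * lam ^ 4|
              ≤ (k : ℝ) * ((k : ℝ) + 1) + |M| + 4 * π ^ 2 * lam ^ 4 := by
            have e : (k : ℝ) * ((k : ℝ) + 1) - χ + 4 * π ^ 2 * lam ^ 4
                = ((k : ℝ) * ((k : ℝ) + 1) + 4 * π ^ 2 * lam ^ 4) + (-χ) := by ring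
            rw [e]
            refine (abs_add_le _ _).trans ?_
            rw [abs_of_nonneg (by positivity), abs_neg]
            linarith
          have t1 : |((k : ℝ) * ((k : ℝ) + 1) - χ + 4 * π ^ 2 * lam ^ 4) * frobCoeff lam χ k|
              * ρ₀ ^ k ≤ ((k : ℝ) * ((k : ℝ) + 1) + |M| + 4 * π ^ 2 * lam ^ 4) * P := by
            rw [abs_mul, mul_assoc]
            exact mul_le_mul hc h0 (by positivity) (by positivity)
          have t2 : |8 * π ^ 2 * lam ^ 3 * frobPrev lam χ k| * ρ₀ ^ k
              ≤ 8 * π ^ 2 * lam ^ 3 * (ρ₀ * P) := by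
            rw [abs_mul, mul_assoc, abs_of_nonneg (by positivity : (0 : ℝ) ≤ 8 * π ^ 2 * lam ^ 3)]
            exact mul_le_mul_of_nonneg_left h1 (by positivity)
          have t3 : |4 * π ^ 2 * lam ^ 2 * frobPrev₂ lam χ k| * ρ₀ ^ k
              ≤ 4 * π ^ 2 * lam ^ 2 * (ρ₀ ^ 2 * P) := by
            rw [abs_mul, mul_assoc, abs_of_nonneg (by positivity : (0 : ℝ) ≤ 4 * π ^ 2 * lam ^ 2)]
            exact mul_le_mul_of_nonneg_left h2 (by positivity)
          have hρk : 0 ≤ ρ₀ ^ k := by positivity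
          calc _ ≤ (|((k : ℝ) * ((k : ℝ) + 1) - χ + 4 * π ^ 2 * lam ^ 4) * frobCoeff lam χ k|
                  + |8 * π ^ 2 * lam ^ 3 * frobPrev lam χ k|
                  + |4 * π ^ 2 * lam ^ 2 * frobPrev₂ lam χ k|) * ρ₀ ^ k := by
                apply mul_le_mul_of_nonneg_right _ hρk
                exact (abs_add_le _ _).trans (add_le_add (abs_sub _ _) le_rfl)
            _ ≤ ((k : ℝ) * ((k : ℝ) + 1) + |M| + 4 * π ^ 2 * lam ^ 4) * P
                  + 8 * π ^ 2 * lam ^ 3 * (ρ₀ * P) + 4 * π ^ 2 * lam ^ 2 * (ρ₀ ^ 2 * P) := by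
                rw [add_mul, add_mul]; exact add_le_add (add_le_add t1 t2) t3
            _ = ((k : ℝ) * ((k : ℝ) + 1) + E) * P := by rw [hE]; ring
        have step : |frobCoeff lam χ (k + 1)| * ρ₀ ^ (k + 1)
            ≤ ((k : ℝ) * ((k : ℝ) + 1) + E) * ρ₀ / (2 * lam * ((k : ℝ) + 1) ^ 2) * P := by
          rw [frobCoeff_succ, abs_div, abs_of_pos hden, pow_succ ρ₀ k]
          rw [div_mul_eq_mul_div, div_mul_eq_mul_div, div_le_div_iff_of_pos_right hden]
          calc _ = (|((k : ℝ) * ((k : ℝ) + 1) - χ + 4 * π ^ 2 * lam ^ 4) * frobCoeff lam χ k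
                  - 8 * π ^ 2 * lam ^ 3 * frobPrev lam χ k + 4 * π ^ 2 * lam ^ 2 * frobPrev₂ lam χ k|
                  * ρ₀ ^ k) * ρ₀ := by ring
            _ ≤ ((k : ℝ) * ((k : ℝ) + 1) + E) * P * ρ₀ := mul_le_mul_of_nonneg_right hnum hρ₀
            _ = _ := by ring
        refine step.trans ?_
        rcases lt_or_ge k K₀ with hk | hk
        · have hmin : min (k + 1) K₀ = min k K₀ + 1 := by
            rw [min_eq_left (by omega), min_eq_left hk.le]
          rw [hmin, pow_succ Θ (min k K₀), ← hP]
          calc _ ≤ Θ * P := mul_le_mul_of_nonneg_right (hθ₁ k) hP0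
            _ = P * Θ := mul_comm _ _
        · have hmin : min (k + 1) K₀ = min k K₀ := by
            rw [min_eq_right (by omega), min_eq_right hk]
          rw [hmin, ← hP]
          calc _ ≤ 1 * P := mul_le_mul_of_nonneg_right (hθ₂ k hk) hP0
            _ = P := one_mul P
      · rw [frobPrev_succ, pow_succ ρ₀ k, ← mul_assoc]
        calc |frobCoeff lam χ k| * ρ₀ ^ k * ρ₀ ≤ P * ρ₀ := mul_le_mul_of_nonneg_right h0 hρ₀
          _ ≤ Θ ^ min (k + 1) K₀ * ρ₀ := mul_le_mul_of_nonneg_right hmono hρ₀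
          _ = _ := mul_comm _ _
      · rw [frobPrev₂_succ, pow_succ ρ₀ k, ← mul_assoc]
        calc |frobPrev lam χ k| * ρ₀ ^ k * ρ₀ ≤ ρ₀ * P * ρ₀ := mul_le_mul_of_nonneg_right h1 hρ₀
          _ ≤ ρ₀ * Θ ^ min (k + 1) K₀ * ρ₀ := by gcongr
          _ = _ := by ring
  intro k
  exact (key k).1.trans (pow_le_pow_right₀ hΘ1 (min_le_right _ _))

/-- An elementary inequality: `(k+1)^p ≤ 2^p (k^p + 1)` (polynomial weights are dominated by a
geometric change of radius). [folklore] -/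
theorem succ_pow_le_two_pow_mul_pow_add_one (k p : ℕ) :
    ((k : ℝ) + 1) ^ p ≤ 2 ^ p * ((k : ℝ) ^ p + 1) := by
  have h2p : (1 : ℝ) ≤ 2 ^ p := one_le_pow₀ (by norm_num)
  rcases Nat.eq_zero_or_pos k with rfl | hk
  · simp only [Nat.cast_zero, zero_add, one_pow]
    have : (0 : ℝ) ≤ 2 ^ p * (0 : ℝ) ^ p := by positivity
    nlinarith
  · have h1 : (1 : ℝ) ≤ k := by exact_mod_cast hk
    have h3 : (0 : ℝ) ≤ 2 ^ p := by positivity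
    calc ((k : ℝ) + 1) ^ p ≤ (2 * (k : ℝ)) ^ p := by
          apply pow_le_pow_left₀ (by positivity); linarith
      _ = 2 ^ p * (k : ℝ) ^ p := by rw [mul_pow]
      _ ≤ _ := by nlinarith

/-- **Uniform summable majorant.**  For `0 ≤ ρ < 2λ`, `M`, and shifts `p, j`: a summable `u` with
`(k+1)^p |a_{k+j}(χ)| ρ^k ≤ u_k` for all `|χ| ≤ M`. [cite: CoddingtonLevinson1955, Ch. 4 §8] -/
theorem frobCoeff_majorant (hlam : 0 < lam) {ρ : ℝ} (hρ0 : 0 ≤ ρ) (hρ : ρ < 2 * lam) (M : ℝ)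
    (p j : ℕ) : ∃ u : ℕ → ℝ, Summable u ∧
      ∀ χ : ℝ, |χ| ≤ M → ∀ k : ℕ, ((k : ℝ) + 1) ^ p * |frobCoeff lam χ (k + j)| * ρ ^ k ≤ u k := by
  obtain ⟨ρ₀, hρρ₀, hρ₀2⟩ : ∃ ρ₀ : ℝ, ρ < ρ₀ ∧ ρ₀ < 2 * lam :=
    ⟨(ρ + 2 * lam) / 2, by linarith, by linarith⟩
  have hρ₀0 : 0 < ρ₀ := lt_of_le_of_lt hρ0 hρρ₀
  obtain ⟨C, hC, hb⟩ := frobCoeff_bound hlam hρ₀0.le hρ₀2 M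
  set r : ℝ := ρ / ρ₀ with hr
  have hr0 : 0 ≤ r := div_nonneg hρ0 hρ₀0.le
  have hr1 : r < 1 := (div_lt_one hρ₀0).mpr hρρ₀
  have hrn : ‖r‖ < 1 := by rw [Real.norm_of_nonneg hr0]; exact hr1
  refine ⟨fun k ↦ C / ρ₀ ^ j * (2 ^ p * ((k : ℝ) ^ p + 1) * r ^ k), ?_, ?_⟩
  · refine Summable.mul_left _ ?_
    have h1 : Summable fun k : ℕ ↦ (k : ℝ) ^ p * r ^ k :=
      summable_pow_mul_geometric_of_norm_lt_one p hrn
    have h2 : Summable fun k : ℕ ↦ r ^ k := summable_geometric_of_lt_one hr0 hr1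
    exact ((h1.add h2).mul_left (2 ^ p)).congr fun k ↦ by ring
  · intro χ hχ k
    have hkj := hb χ hχ (k + j)
    have hρ₀kj : 0 < ρ₀ ^ (k + j) := pow_pos hρ₀0 _
    have ha : |frobCoeff lam χ (k + j)| ≤ C / ρ₀ ^ (k + j) := by
      rw [le_div_iff₀ hρ₀kj]; exact hkj
    have hpk := succ_pow_le_two_pow_mul_pow_add_one k p
    calc ((k : ℝ) + 1) ^ p * |frobCoeff lam χ (k + j)| * ρ ^ k
        ≤ (2 ^ p * ((k : ℝ) ^ p + 1)) * (C / ρ₀ ^ (k + j)) * ρ ^ k := by gcongr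
      _ = C / ρ₀ ^ j * (2 ^ p * ((k : ℝ) ^ p + 1) * r ^ k) := by
          rw [hr, div_pow, pow_add]
          have h2 : ρ₀ ^ k ≠ 0 := pow_ne_zero _ hρ₀0.ne'
          have h3 : ρ₀ ^ j ≠ 0 := pow_ne_zero _ hρ₀0.ne'
          field_simp

/-- Comparison summability: anything bounded term-wise by a constant multiple of the weighted
coefficient series `(k+1)^p |a_{k+j}| |t|^k`, `|t| < 2λ`, is summable.
[cite: CoddingtonLevinson1955, Ch. 4 §8] -/
theorem summable_of_le_frobCoeff (hlam : 0 < lam) (χ : ℝ) {t : ℝ} (ht : |t| < 2 * lam) (p j : ℕ)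
    {K : ℝ} {g : ℕ → ℝ}
    (hg : ∀ k : ℕ, |g k| ≤ K * (((k : ℝ) + 1) ^ p * |frobCoeff lam χ (k + j)| * |t| ^ k)) :
    Summable g := by
  obtain ⟨u, hu, hb⟩ := frobCoeff_majorant hlam (abs_nonneg t) ht |χ| p j
  refine Summable.of_norm_bounded (hu.mul_left |K|) fun k ↦ ?_
  rw [Real.norm_eq_abs]
  refine (hg k).trans ?_
  have h0 : 0 ≤ ((k : ℝ) + 1) ^ p * |frobCoeff lam χ (k + j)| * |t| ^ k := by positivity
  calc K * (((k : ℝ) + 1) ^ p * |frobCoeff lam χ (k + j)| * |t| ^ k)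
      ≤ |K| * (((k : ℝ) + 1) ^ p * |frobCoeff lam χ (k + j)| * |t| ^ k) :=
        mul_le_mul_of_nonneg_right (le_abs_self K) h0
    _ ≤ |K| * u k := mul_le_mul_of_nonneg_left (hb χ le_rfl k) (abs_nonneg K)

/-! ### Term-wise differentiation and joint continuity of real power series -/

/-- Term-wise differentiation of `z ↦ Σ c_k z^k` at `|s| < ρ`, given a summable majorant of the
differentiated coefficients `(k+1)|c_{k+1}|ρ^k`. [folklore] -/
theorem hasDerivAt_tsum_mul_pow {c : ℕ → ℝ} {ρ : ℝ} {u : ℕ → ℝ} (hu : Summable u)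
    (hcu : ∀ k : ℕ, ((k : ℝ) + 1) * |c (k + 1)| * ρ ^ k ≤ u k) {s : ℝ} (hs : |s| < ρ) :
    HasDerivAt (fun z ↦ ∑' k : ℕ, c k * z ^ k)
      (∑' k : ℕ, ((k : ℝ) + 1) * c (k + 1) * s ^ k) s := by
  have hρ : 0 < ρ := lt_of_le_of_lt (abs_nonneg s) hs
  have hsρ : |s| ≤ ρ := hs.le
  have hst : s ∈ Ioo (-ρ) ρ := ⟨by linarith [neg_abs_le s], lt_of_le_of_lt (le_abs_self s) hs⟩
  have hU : Summable fun n : ℕ ↦ (n : ℝ) * |c n| * ρ ^ (n - 1) := by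
    rw [← summable_nat_add_iff 1]
    refine Summable.of_nonneg_of_le (fun n ↦ by positivity) (fun n ↦ ?_) hu
    simp only [Nat.cast_succ, Nat.add_sub_cancel]
    exact hcu n
  have hg : ∀ n : ℕ, ∀ y ∈ Ioo (-ρ) ρ,
      HasDerivAt (fun z ↦ c n * z ^ n) (c n * ((n : ℝ) * y ^ (n - 1))) y :=
    fun n y _ ↦ (hasDerivAt_pow n y).const_mul (c n)
  have hg' : ∀ n : ℕ, ∀ y ∈ Ioo (-ρ) ρ,
      ‖c n * ((n : ℝ) * y ^ (n - 1))‖ ≤ (n : ℝ) * |c n| * ρ ^ (n - 1) := by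
    intro n y hy
    have hy' : |y| ≤ ρ := (abs_lt.mpr ⟨hy.1, hy.2⟩).le
    rw [Real.norm_eq_abs, abs_mul, abs_mul, abs_pow, Nat.abs_cast]
    calc |c n| * ((n : ℝ) * |y| ^ (n - 1)) ≤ |c n| * ((n : ℝ) * ρ ^ (n - 1)) := by gcongr
      _ = _ := by ring
  have hg0 : Summable fun n : ℕ ↦ c n * (0 : ℝ) ^ n := by
    refine (hasSum_single (f := fun n : ℕ ↦ c n * (0 : ℝ) ^ n) 0 fun n hn ↦ ?_).summable
    simp [zero_pow hn]
  have hderiv := hasDerivAt_tsum_of_isPreconnected hU isOpen_Ioo isPreconnected_Ioo hg hg'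
    (show (0 : ℝ) ∈ Ioo (-ρ) ρ from ⟨by linarith, hρ⟩) hg0 hst
  -- reindex the derivative series
  have hsum : Summable fun n : ℕ ↦ c (n + 1) * (((n + 1 : ℕ) : ℝ) * s ^ (n + 1 - 1)) := by
    refine Summable.of_norm_bounded hu fun n ↦ ?_
    have e : ‖c (n + 1) * (((n + 1 : ℕ) : ℝ) * s ^ (n + 1 - 1))‖
        = ((n : ℝ) + 1) * |c (n + 1)| * |s| ^ n := by
      rw [Nat.add_sub_cancel, Real.norm_eq_abs, abs_mul, abs_mul, abs_pow, Nat.abs_cast]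
      push_cast
      ring
    rw [e]
    calc ((n : ℝ) + 1) * |c (n + 1)| * |s| ^ n ≤ ((n : ℝ) + 1) * |c (n + 1)| * ρ ^ n := by gcongr
      _ ≤ u n := hcu n
  have e : ∑' n : ℕ, c n * ((n : ℝ) * s ^ (n - 1))
      = ∑' k : ℕ, ((k : ℝ) + 1) * c (k + 1) * s ^ k := by
    have hfull : Summable fun n : ℕ ↦ c n * ((n : ℝ) * s ^ (n - 1)) :=
      (summable_nat_add_iff (f := fun n : ℕ ↦ c n * ((n : ℝ) * s ^ (n - 1))) 1).mp hsum
    rw [hfull.tsum_eq_zero_add]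
    simp only [Nat.cast_zero, zero_mul, mul_zero, zero_add, Nat.add_sub_cancel, Nat.cast_succ]
    exact tsum_congr fun k ↦ by ring
  rw [← e]
  exact hderiv

/-- Continuity of a jointly parametrised series: if the coefficients `c_k(y)` are continuous on `S`
and `|c_k(y)| ρ^k ≤ u_k` there with `Σ u_k < ∞`, then `(y, z) ↦ Σ c_k(y) z^k` is continuous on
`S ×ˢ [−ρ, ρ]`. [folklore] -/
theorem continuousOn_tsum_mul_pow {c : ℕ → ℝ → ℝ} {S : Set ℝ} {ρ : ℝ} {u : ℕ → ℝ}
    (hu : Summable u) (hc : ∀ k, ContinuousOn (c k) S)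
    (hcu : ∀ y ∈ S, ∀ k, |c k y| * ρ ^ k ≤ u k) :
    ContinuousOn (fun p : ℝ × ℝ ↦ ∑' k : ℕ, c k p.1 * p.2 ^ k) (S ×ˢ Icc (-ρ) ρ) := by
  refine continuousOn_tsum (fun k ↦ ?_) hu fun k p hp ↦ ?_
  · exact ((hc k).comp continuousOn_fst fun p hp ↦ (mem_prod.mp hp).1).mul
      ((continuous_pow k).continuousOn.comp continuousOn_snd fun _ _ ↦ mem_univ _)
  · obtain ⟨h1, h2⟩ := mem_prod.mp hp
    have hz : |p.2| ≤ ρ := abs_le.mpr ⟨h2.1, h2.2⟩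
    rw [Real.norm_eq_abs, abs_mul, abs_pow]
    calc |c k p.1| * |p.2| ^ k ≤ |c k p.1| * ρ ^ k := by gcongr
      _ ≤ u k := hcu p.1 h1 k

/-! ### The solution and its derivatives -/

/-- **The principal Frobenius solution** `u_χ(x) = Σ_k a_k(χ) (λ − x)^k` of the prolate equation,
regular at `x = λ` with `u_χ(λ) = 1` (meaningful for `|λ − x| < 2λ`).
[cite: CoddingtonLevinson1955, Ch. 4 §8; SlepianPollak1961, §III] -/
def frobSol (lam χ : ℝ) (x : ℝ) : ℝ := ∑' k : ℕ, frobCoeff lam χ k * (lam - x) ^ k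

/-- The derivative series `u_χ′(x) = −Σ_k (k+1) a_{k+1} (λ − x)^k`.
[cite: CoddingtonLevinson1955, Ch. 4 §8] -/
def frobSol₁ (lam χ : ℝ) (x : ℝ) : ℝ :=
  -∑' k : ℕ, ((k : ℝ) + 1) * frobCoeff lam χ (k + 1) * (lam - x) ^ k

/-- The second-derivative series `u_χ″(x) = Σ_k (k+1)(k+2) a_{k+2} (λ − x)^k`.
[cite: CoddingtonLevinson1955, Ch. 4 §8] -/
def frobSol₂ (lam χ : ℝ) (x : ℝ) : ℝ :=
  ∑' k : ℕ, ((k : ℝ) + 1) * (((k : ℝ) + 2) * frobCoeff lam χ (k + 2)) * (lam - x) ^ k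

/-- `u_χ(λ) = a₀ = 1`. [cite: CoddingtonLevinson1955, Ch. 4 §8] -/
@[simp] theorem frobSol_self (lam χ : ℝ) : frobSol lam χ lam = 1 := by
  rw [frobSol, tsum_eq_single 0 fun k hk ↦ by simp [zero_pow hk]]
  simp

/-- `u_χ′(λ) = −a₁ = (χ − 4π²λ⁴)/(2λ)`. [cite: CoddingtonLevinson1955, Ch. 4 §8] -/
theorem frobSol₁_self (lam χ : ℝ) :
    frobSol₁ lam χ lam = (χ - 4 * π ^ 2 * lam ^ 4) / (2 * lam) := by
  have h : frobSol₁ lam χ lam = -frobCoeff lam χ 1 := by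
    rw [frobSol₁, tsum_eq_single 0 fun k hk ↦ by simp [zero_pow hk]]
    simp
  rw [h, frobCoeff_one]
  ring

/-- `u_χ′ = frobSol₁` on `|λ − x| < 2λ` (term-wise differentiation).
[cite: CoddingtonLevinson1955, Ch. 4 §8] -/
theorem hasDerivAt_frobSol (hlam : 0 < lam) (χ : ℝ) {x : ℝ} (hx : |lam - x| < 2 * lam) :
    HasDerivAt (frobSol lam χ) (frobSol₁ lam χ x) x := by
  obtain ⟨ρ, hρx, hρ2⟩ : ∃ ρ : ℝ, |lam - x| < ρ ∧ ρ < 2 * lam :=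
    ⟨(|lam - x| + 2 * lam) / 2, by linarith, by linarith⟩
  have hρ0 : 0 ≤ ρ := (abs_nonneg _).trans hρx.le
  obtain ⟨u, hu, hb⟩ := frobCoeff_majorant hlam hρ0 hρ2 |χ| 1 1
  have h := hasDerivAt_tsum_mul_pow (c := frobCoeff lam χ) hu
    (fun k ↦ by simpa only [pow_one] using hb χ le_rfl k) hρx
  have hi : HasDerivAt (fun y : ℝ ↦ lam - y) (-1) x := by
    simpa using (hasDerivAt_id x).const_sub lam
  have e : frobSol lam χ
      = (fun z ↦ ∑' k : ℕ, frobCoeff lam χ k * z ^ k) ∘ (fun y : ℝ ↦ lam - y) := rfl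
  rw [e]
  refine (h.comp x hi).congr_deriv ?_
  rw [frobSol₁, mul_neg_one]

/-- `u_χ″ = frobSol₂` on `|λ − x| < 2λ`. [cite: CoddingtonLevinson1955, Ch. 4 §8] -/
theorem hasDerivAt_frobSol₁ (hlam : 0 < lam) (χ : ℝ) {x : ℝ} (hx : |lam - x| < 2 * lam) :
    HasDerivAt (frobSol₁ lam χ) (frobSol₂ lam χ x) x := by
  obtain ⟨ρ, hρx, hρ2⟩ : ∃ ρ : ℝ, |lam - x| < ρ ∧ ρ < 2 * lam :=
    ⟨(|lam - x| + 2 * lam) / 2, by linarith, by linarith⟩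
  have hρ0 : 0 ≤ ρ := (abs_nonneg _).trans hρx.le
  obtain ⟨u, hu, hb⟩ := frobCoeff_majorant hlam hρ0 hρ2 |χ| 2 2
  have hb' : ∀ k : ℕ, ((k : ℝ) + 1) * |(((k + 1 : ℕ) : ℝ) + 1) * frobCoeff lam χ (k + 1 + 1)|
      * ρ ^ k ≤ 2 * u k := by
    intro k
    have h1 : (0 : ℝ) ≤ (k : ℝ) + 1 + 1 := by positivity
    have e : |(((k + 1 : ℕ) : ℝ) + 1) * frobCoeff lam χ (k + 1 + 1)|
        = ((k : ℝ) + 2) * |frobCoeff lam χ (k + 2)| := by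
      rw [abs_mul, show k + 1 + 1 = k + 2 from rfl]
      push_cast
      rw [abs_of_nonneg h1]
      ring
    rw [e]
    have := hb χ le_rfl k
    have hk : (k : ℝ) + 2 ≤ 2 * ((k : ℝ) + 1) := by linarith
    calc ((k : ℝ) + 1) * (((k : ℝ) + 2) * |frobCoeff lam χ (k + 2)|) * ρ ^ k
        = ((k : ℝ) + 2) * (((k : ℝ) + 1) * (|frobCoeff lam χ (k + 2)| * ρ ^ k)) := by ring
      _ ≤ (2 * ((k : ℝ) + 1)) * (((k : ℝ) + 1) * (|frobCoeff lam χ (k + 2)| * ρ ^ k)) := by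
          gcongr
      _ = 2 * (((k : ℝ) + 1) ^ 2 * |frobCoeff lam χ (k + 2)| * ρ ^ k) := by ring
      _ ≤ 2 * u k := by linarith
  have h := hasDerivAt_tsum_mul_pow (c := fun k ↦ ((k : ℝ) + 1) * frobCoeff lam χ (k + 1))
    (hu.mul_left 2) hb' hρx
  have hi : HasDerivAt (fun y : ℝ ↦ lam - y) (-1) x := by
    simpa using (hasDerivAt_id x).const_sub lam
  have e : frobSol₁ lam χ = fun y ↦ -(((fun z ↦ ∑' k : ℕ,
      ((k : ℝ) + 1) * frobCoeff lam χ (k + 1) * z ^ k) ∘ (fun y : ℝ ↦ lam - y)) y) := rfl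
  rw [e]
  have hc : HasDerivAt (fun y ↦ -(((fun z ↦ ∑' k : ℕ,
      ((k : ℝ) + 1) * frobCoeff lam χ (k + 1) * z ^ k) ∘ (fun y : ℝ ↦ lam - y)) y)) _ x :=
    (h.comp x hi).neg
  refine hc.congr_deriv ?_
  rw [frobSol₂, mul_neg_one, neg_neg]
  refine tsum_congr fun k ↦ ?_
  rw [show k + 1 + 1 = k + 2 from rfl]
  push_cast
  ring

/-- `u_χ″ = frobSol₂` is differentiable (hence continuous) on `|λ − x| < 2λ`.
[cite: CoddingtonLevinson1955, Ch. 4 §8] -/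
theorem differentiableAt_frobSol₂ (hlam : 0 < lam) (χ : ℝ) {x : ℝ} (hx : |lam - x| < 2 * lam) :
    DifferentiableAt ℝ (frobSol₂ lam χ) x := by
  obtain ⟨ρ, hρx, hρ2⟩ : ∃ ρ : ℝ, |lam - x| < ρ ∧ ρ < 2 * lam :=
    ⟨(|lam - x| + 2 * lam) / 2, by linarith, by linarith⟩
  have hρ0 : 0 ≤ ρ := (abs_nonneg _).trans hρx.le
  obtain ⟨u, hu, hb⟩ := frobCoeff_majorant hlam hρ0 hρ2 |χ| 3 3
  have hb' : ∀ k : ℕ, ((k : ℝ) + 1)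
      * |(((k + 1 : ℕ) : ℝ) + 1) * ((((k + 1 : ℕ) : ℝ) + 2) * frobCoeff lam χ (k + 1 + 2))|
      * ρ ^ k ≤ 6 * u k := by
    intro k
    have h1 : (0 : ℝ) ≤ (k : ℝ) + 1 + 1 := by positivity
    have h2 : (0 : ℝ) ≤ (k : ℝ) + 1 + 2 := by positivity
    have e : |(((k + 1 : ℕ) : ℝ) + 1) * ((((k + 1 : ℕ) : ℝ) + 2) * frobCoeff lam χ (k + 1 + 2))|
        = ((k : ℝ) + 2) * (((k : ℝ) + 3) * |frobCoeff lam χ (k + 3)|) := by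
      rw [abs_mul, abs_mul, show k + 1 + 2 = k + 3 from rfl]
      push_cast
      rw [abs_of_nonneg h1, abs_of_nonneg h2]
      ring
    rw [e]
    have := hb χ le_rfl k
    have hk1 : (k : ℝ) + 2 ≤ 2 * ((k : ℝ) + 1) := by linarith
    have hk2 : (k : ℝ) + 3 ≤ 3 * ((k : ℝ) + 1) := by linarith
    calc ((k : ℝ) + 1) * (((k : ℝ) + 2) * (((k : ℝ) + 3) * |frobCoeff lam χ (k + 3)|)) * ρ ^ k
        = ((k : ℝ) + 2) * (((k : ℝ) + 3)
            * (((k : ℝ) + 1) * (|frobCoeff lam χ (k + 3)| * ρ ^ k))) := by ring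
      _ ≤ (2 * ((k : ℝ) + 1)) * ((3 * ((k : ℝ) + 1))
            * (((k : ℝ) + 1) * (|frobCoeff lam χ (k + 3)| * ρ ^ k))) := by gcongr
      _ = 6 * (((k : ℝ) + 1) ^ 3 * |frobCoeff lam χ (k + 3)| * ρ ^ k) := by ring
      _ ≤ 6 * u k := by linarith
  have h := hasDerivAt_tsum_mul_pow
    (c := fun k ↦ ((k : ℝ) + 1) * (((k : ℝ) + 2) * frobCoeff lam χ (k + 2)))
    (hu.mul_left 6) hb' hρx
  have hi : HasDerivAt (fun y : ℝ ↦ lam - y) (-1) x := by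
    simpa using (hasDerivAt_id x).const_sub lam
  have e : frobSol₂ lam χ = (fun z ↦ ∑' k : ℕ,
      ((k : ℝ) + 1) * (((k : ℝ) + 2) * frobCoeff lam χ (k + 2)) * z ^ k)
        ∘ (fun y : ℝ ↦ lam - y) := rfl
  rw [e]
  exact (h.comp x hi).differentiableAt

/-- `u_χ` is `C²` on `(−λ, 3λ)`. [cite: CoddingtonLevinson1955, Ch. 4 §8] -/
theorem contDiffOn_frobSol (hlam : 0 < lam) (χ : ℝ) :
    ContDiffOn ℝ 2 (frobSol lam χ) (Ioo (-lam) (3 * lam)) := by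
  have hmem : ∀ x ∈ Ioo (-lam) (3 * lam), |lam - x| < 2 * lam := fun x hx ↦
    abs_lt.mpr ⟨by linarith [hx.2], by linarith [hx.1]⟩
  have hd1 : ∀ x ∈ Ioo (-lam) (3 * lam), deriv (frobSol lam χ) x = frobSol₁ lam χ x :=
    fun x hx ↦ (hasDerivAt_frobSol hlam χ (hmem x hx)).deriv
  have hd2 : ∀ x ∈ Ioo (-lam) (3 * lam), deriv (frobSol₁ lam χ) x = frobSol₂ lam χ x :=
    fun x hx ↦ (hasDerivAt_frobSol₁ hlam χ (hmem x hx)).deriv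
  have hdd : ∀ x ∈ Ioo (-lam) (3 * lam), deriv (deriv (frobSol lam χ)) x = frobSol₂ lam χ x := by
    intro x hx
    rw [← hd2 x hx]
    refine Filter.EventuallyEq.deriv_eq ?_
    filter_upwards [isOpen_Ioo.mem_nhds hx] with z hz using hd1 z hz
  rw [show (2 : WithTop ℕ∞) = 1 + 1 from by norm_num,
    contDiffOn_succ_iff_deriv_of_isOpen isOpen_Ioo]
  refine ⟨fun x hx ↦
    (hasDerivAt_frobSol hlam χ (hmem x hx)).differentiableAt.differentiableWithinAt, by simp, ?_⟩
  rw [show (1 : WithTop ℕ∞) = 0 + 1 from by norm_num,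
    contDiffOn_succ_iff_deriv_of_isOpen isOpen_Ioo]
  refine ⟨?_, by simp, ?_⟩
  · intro x hx
    exact ((hasDerivAt_frobSol₁ hlam χ (hmem x hx)).differentiableAt.differentiableWithinAt
      (s := Ioo (-lam) (3 * lam))).congr (fun y hy ↦ hd1 y hy) (hd1 x hx)
  · rw [contDiffOn_zero]
    have hc2 : ContinuousOn (frobSol₂ lam χ) (Ioo (-lam) (3 * lam)) := fun x hx ↦
      (differentiableAt_frobSol₂ hlam χ (hmem x hx)).continuousAt.continuousWithinAt
    exact hc2.congr fun y hy ↦ hdd y hy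

/-! ### The differential equation -/

/-- A shift identity for power series: if `d₀ = 0` then `Σ_k d_k t^k = t · Σ_k d_{k+1} t^k`.
[folklore] -/
theorem tsum_mul_pow_eq_mul_tsum_succ {d : ℕ → ℝ} {t : ℝ} (hd : d 0 = 0)
    (hs : Summable fun k : ℕ ↦ d (k + 1) * t ^ k) :
    ∑' k : ℕ, d k * t ^ k = t * ∑' k : ℕ, d (k + 1) * t ^ k := by
  have hs' : Summable fun k : ℕ ↦ d (k + 1) * t ^ (k + 1) :=
    (hs.mul_right t).congr fun k ↦ by ring
  have hfull : Summable fun k : ℕ ↦ d k * t ^ k :=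
    (summable_nat_add_iff (f := fun k : ℕ ↦ d k * t ^ k) 1).mp hs'
  rw [hfull.tsum_eq_zero_add, hd, zero_mul, zero_add, ← tsum_mul_left]
  exact tsum_congr fun k ↦ by simp only [pow_succ]; ring

/-- **The prolate equation for the Frobenius solution** (pointwise form with the explicit derivative
series): `(λ² − x²) u″ − 2x u′ + (χ − (2πλx)²) u = 0` for `|λ − x| < 2λ`.  Proof: substitute the three
series, shift indices, and use the recursion `frobCoeff_rec` coefficient-wise.
[cite: CoddingtonLevinson1955, Ch. 4 §8; SlepianPollak1961, §III eq. (11)] -/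
theorem frobSol_ode (hlam : 0 < lam) (χ : ℝ) {x : ℝ} (hx : |lam - x| < 2 * lam) :
    (lam ^ 2 - x ^ 2) * frobSol₂ lam χ x - 2 * x * frobSol₁ lam χ x
      + (χ - (2 * π * lam * x) ^ 2) * frobSol lam χ x = 0 := by
  obtain ⟨t, rfl⟩ : ∃ t : ℝ, x = lam - t := ⟨lam - x, by ring⟩
  have hlt : lam - (lam - t) = t := by ring
  have htt : |t| < 2 * lam := by simpa [hlt] using hx
  simp only [frobSol, frobSol₁, frobSol₂, hlt]
  -- the seven summable series
  have hA0 : Summable fun k : ℕ ↦ frobCoeff lam χ k * t ^ k :=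
    summable_of_le_frobCoeff hlam χ htt 0 0 (K := 1) fun k ↦ by simp [abs_mul, abs_pow]
  have hA1 : Summable fun k : ℕ ↦ ((k : ℝ) + 1) * frobCoeff lam χ (k + 1) * t ^ k :=
    summable_of_le_frobCoeff hlam χ htt 1 1 (K := 1) fun k ↦ by
      simp [abs_mul, abs_pow, abs_of_nonneg (by positivity : (0 : ℝ) ≤ (k : ℝ) + 1)]
  have hA2 : Summable fun k : ℕ ↦
      ((k : ℝ) + 1) * (((k : ℝ) + 2) * frobCoeff lam χ (k + 2)) * t ^ k :=
    summable_of_le_frobCoeff hlam χ htt 2 2 (K := 2) fun k ↦ by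
      have h1 : (0 : ℝ) ≤ (k : ℝ) + 1 := by positivity
      have h2 : (0 : ℝ) ≤ (k : ℝ) + 2 := by positivity
      have e : |((k : ℝ) + 1) * (((k : ℝ) + 2) * frobCoeff lam χ (k + 2)) * t ^ k|
          = ((k : ℝ) + 1) * (((k : ℝ) + 2) * |frobCoeff lam χ (k + 2)|) * |t| ^ k := by
        rw [abs_mul, abs_mul, abs_mul, abs_pow, abs_of_nonneg h1, abs_of_nonneg h2]
      rw [e]
      have hk : (k : ℝ) + 2 ≤ 2 * ((k : ℝ) + 1) := by linarith
      calc ((k : ℝ) + 1) * (((k : ℝ) + 2) * |frobCoeff lam χ (k + 2)|) * |t| ^ k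
          = ((k : ℝ) + 2) * (((k : ℝ) + 1) * (|frobCoeff lam χ (k + 2)| * |t| ^ k)) := by ring
        _ ≤ (2 * ((k : ℝ) + 1)) * (((k : ℝ) + 1) * (|frobCoeff lam χ (k + 2)| * |t| ^ k)) := by
            gcongr
        _ = 2 * (((k : ℝ) + 1) ^ 2 * |frobCoeff lam χ (k + 2)| * |t| ^ k) := by ring
  have hB1 : Summable fun k : ℕ ↦ (k : ℝ) * frobCoeff lam χ k * t ^ k :=
    summable_of_le_frobCoeff hlam χ htt 1 0 (K := 1) fun k ↦ by
      have e : |(k : ℝ) * frobCoeff lam χ k * t ^ k| = (k : ℝ) * |frobCoeff lam χ k| * |t| ^ k := by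
        rw [abs_mul, abs_mul, abs_pow, Nat.abs_cast]
      have hk1 : (k : ℝ) ≤ (k : ℝ) + 1 := by linarith
      rw [e, one_mul, pow_one, add_zero]
      gcongr
  have hB2 : Summable fun k : ℕ ↦ ((k : ℝ) + 1) * ((k : ℝ) * frobCoeff lam χ (k + 1)) * t ^ k :=
    summable_of_le_frobCoeff hlam χ htt 2 1 (K := 1) fun k ↦ by
      have h1 : (0 : ℝ) ≤ (k : ℝ) + 1 := by positivity
      have e : |((k : ℝ) + 1) * ((k : ℝ) * frobCoeff lam χ (k + 1)) * t ^ k|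
          = ((k : ℝ) + 1) * ((k : ℝ) * |frobCoeff lam χ (k + 1)|) * |t| ^ k := by
        rw [abs_mul, abs_mul, abs_mul, abs_pow, abs_of_nonneg h1, Nat.abs_cast]
      have hk1 : (k : ℝ) ≤ (k : ℝ) + 1 := by linarith
      rw [e, one_mul]
      calc ((k : ℝ) + 1) * ((k : ℝ) * |frobCoeff lam χ (k + 1)|) * |t| ^ k
          = (k : ℝ) * (((k : ℝ) + 1) * (|frobCoeff lam χ (k + 1)| * |t| ^ k)) := by ring
        _ ≤ ((k : ℝ) + 1) * (((k : ℝ) + 1) * (|frobCoeff lam χ (k + 1)| * |t| ^ k)) := by gcongr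
        _ = ((k : ℝ) + 1) ^ 2 * |frobCoeff lam χ (k + 1)| * |t| ^ k := by ring
  have hB3 : Summable fun k : ℕ ↦ (k : ℝ) * ((k : ℝ) - 1) * frobCoeff lam χ k * t ^ k :=
    summable_of_le_frobCoeff hlam χ htt 2 0 (K := 1) fun k ↦ by
      have e : |(k : ℝ) * ((k : ℝ) - 1) * frobCoeff lam χ k * t ^ k|
          = (k : ℝ) * |(k : ℝ) - 1| * |frobCoeff lam χ k| * |t| ^ k := by
        rw [abs_mul, abs_mul, abs_mul, abs_pow, Nat.abs_cast]
      have h1 : |(k : ℝ) - 1| ≤ (k : ℝ) + 1 := by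
        rw [abs_le]; constructor <;> linarith [(Nat.cast_nonneg k : (0 : ℝ) ≤ k)]
      have hk1 : (k : ℝ) ≤ (k : ℝ) + 1 := by linarith
      rw [e, one_mul, add_zero]
      calc (k : ℝ) * |(k : ℝ) - 1| * |frobCoeff lam χ k| * |t| ^ k
          ≤ ((k : ℝ) + 1) * ((k : ℝ) + 1) * |frobCoeff lam χ k| * |t| ^ k := by gcongr
        _ = ((k : ℝ) + 1) ^ 2 * |frobCoeff lam χ k| * |t| ^ k := by ring
  have hP1 : Summable fun k : ℕ ↦ frobPrev lam χ k * t ^ k := by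
    rw [← summable_nat_add_iff 1]
    simp only [frobPrev_succ]
    exact (hA0.mul_right t).congr fun k ↦ by ring
  have hP2 : Summable fun k : ℕ ↦ frobPrev₂ lam χ k * t ^ k := by
    rw [← summable_nat_add_iff 1]
    simp only [frobPrev₂_succ]
    exact (hP1.mul_right t).congr fun k ↦ by ring
  -- the five shift identities
  have e1 : ∑' k : ℕ, (k : ℝ) * frobCoeff lam χ k * t ^ k
      = t * ∑' k : ℕ, ((k : ℝ) + 1) * frobCoeff lam χ (k + 1) * t ^ k := by
    have := tsum_mul_pow_eq_mul_tsum_succ (d := fun k ↦ (k : ℝ) * frobCoeff lam χ k) (t := t)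
      (by simp) (by simpa only [Nat.cast_succ] using hA1)
    simpa only [Nat.cast_succ] using this
  have e2 : ∑' k : ℕ, ((k : ℝ) + 1) * ((k : ℝ) * frobCoeff lam χ (k + 1)) * t ^ k
      = t * ∑' k : ℕ, ((k : ℝ) + 1) * (((k : ℝ) + 2) * frobCoeff lam χ (k + 2)) * t ^ k := by
    have := tsum_mul_pow_eq_mul_tsum_succ
      (d := fun k ↦ ((k : ℝ) + 1) * ((k : ℝ) * frobCoeff lam χ (k + 1))) (t := t) (by simp)
      (hA2.congr fun k ↦ by
        rw [show k + 1 + 1 = k + 2 from rfl]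
        push_cast
        ring)
    refine this.trans ?_
    congr 1
    refine tsum_congr fun k ↦ ?_
    rw [show k + 1 + 1 = k + 2 from rfl]
    push_cast
    ring
  have e3 : ∑' k : ℕ, (k : ℝ) * ((k : ℝ) - 1) * frobCoeff lam χ k * t ^ k
      = t * ∑' k : ℕ, ((k : ℝ) + 1) * ((k : ℝ) * frobCoeff lam χ (k + 1)) * t ^ k := by
    have := tsum_mul_pow_eq_mul_tsum_succ
      (d := fun k ↦ (k : ℝ) * ((k : ℝ) - 1) * frobCoeff lam χ k) (t := t) (by simp)
      (hB2.congr fun k ↦ by push_cast; ring)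
    refine this.trans ?_
    congr 1
    exact tsum_congr fun k ↦ by push_cast; ring
  have e4 : ∑' k : ℕ, frobPrev lam χ k * t ^ k = t * ∑' k : ℕ, frobCoeff lam χ k * t ^ k := by
    have := tsum_mul_pow_eq_mul_tsum_succ (d := frobPrev lam χ) (t := t) frobPrev_zero
      (by simpa only [frobPrev_succ] using hA0)
    simpa only [frobPrev_succ] using this
  have e5 : ∑' k : ℕ, frobPrev₂ lam χ k * t ^ k = t * ∑' k : ℕ, frobPrev lam χ k * t ^ k := by
    have := tsum_mul_pow_eq_mul_tsum_succ (d := frobPrev₂ lam χ) (t := t) frobPrev₂_zero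
      (by simpa only [frobPrev₂_succ] using hP1)
    simpa only [frobPrev₂_succ] using this
  -- the recursion, coefficient-wise
  have key : ∀ k : ℕ,
      2 * lam * (((k : ℝ) + 1) * ((k : ℝ) * frobCoeff lam χ (k + 1)))
        - (k : ℝ) * ((k : ℝ) - 1) * frobCoeff lam χ k
        + 2 * lam * (((k : ℝ) + 1) * frobCoeff lam χ (k + 1))
        - 2 * ((k : ℝ) * frobCoeff lam χ k)
        + (χ - 4 * π ^ 2 * lam ^ 4) * frobCoeff lam χ k
        + 8 * π ^ 2 * lam ^ 3 * frobPrev lam χ k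
        - 4 * π ^ 2 * lam ^ 2 * frobPrev₂ lam χ k = 0 := by
    intro k
    linear_combination frobCoeff_rec (χ := χ) hlam.ne' k
  -- the combined series sums to `V` and to `0`
  have H : HasSum (fun k : ℕ ↦
      2 * lam * (((k : ℝ) + 1) * ((k : ℝ) * frobCoeff lam χ (k + 1)) * t ^ k)
        - (k : ℝ) * ((k : ℝ) - 1) * frobCoeff lam χ k * t ^ k
        + 2 * lam * (((k : ℝ) + 1) * frobCoeff lam χ (k + 1) * t ^ k)
        - 2 * ((k : ℝ) * frobCoeff lam χ k * t ^ k)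
        + (χ - 4 * π ^ 2 * lam ^ 4) * (frobCoeff lam χ k * t ^ k)
        + 8 * π ^ 2 * lam ^ 3 * (frobPrev lam χ k * t ^ k)
        - 4 * π ^ 2 * lam ^ 2 * (frobPrev₂ lam χ k * t ^ k))
      (2 * lam * (∑' k : ℕ, ((k : ℝ) + 1) * ((k : ℝ) * frobCoeff lam χ (k + 1)) * t ^ k)
        - (∑' k : ℕ, (k : ℝ) * ((k : ℝ) - 1) * frobCoeff lam χ k * t ^ k)
        + 2 * lam * (∑' k : ℕ, ((k : ℝ) + 1) * frobCoeff lam χ (k + 1) * t ^ k)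
        - 2 * (∑' k : ℕ, (k : ℝ) * frobCoeff lam χ k * t ^ k)
        + (χ - 4 * π ^ 2 * lam ^ 4) * (∑' k : ℕ, frobCoeff lam χ k * t ^ k)
        + 8 * π ^ 2 * lam ^ 3 * (∑' k : ℕ, frobPrev lam χ k * t ^ k)
        - 4 * π ^ 2 * lam ^ 2 * (∑' k : ℕ, frobPrev₂ lam χ k * t ^ k)) :=
    ((((((hB2.hasSum.mul_left (2 * lam)).sub hB3.hasSum).add (hA1.hasSum.mul_left (2 * lam))).sub
      (hB1.hasSum.mul_left 2)).add (hA0.hasSum.mul_left _)).add (hP1.hasSum.mul_left _)).sub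
      (hP2.hasSum.mul_left _)
  have H' : HasSum (fun k : ℕ ↦
      2 * lam * (((k : ℝ) + 1) * ((k : ℝ) * frobCoeff lam χ (k + 1)) * t ^ k)
        - (k : ℝ) * ((k : ℝ) - 1) * frobCoeff lam χ k * t ^ k
        + 2 * lam * (((k : ℝ) + 1) * frobCoeff lam χ (k + 1) * t ^ k)
        - 2 * ((k : ℝ) * frobCoeff lam χ k * t ^ k)
        + (χ - 4 * π ^ 2 * lam ^ 4) * (frobCoeff lam χ k * t ^ k)
        + 8 * π ^ 2 * lam ^ 3 * (frobPrev lam χ k * t ^ k)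
        - 4 * π ^ 2 * lam ^ 2 * (frobPrev₂ lam χ k * t ^ k)) 0 := by
    have hz : (fun k : ℕ ↦
        2 * lam * (((k : ℝ) + 1) * ((k : ℝ) * frobCoeff lam χ (k + 1)) * t ^ k)
          - (k : ℝ) * ((k : ℝ) - 1) * frobCoeff lam χ k * t ^ k
          + 2 * lam * (((k : ℝ) + 1) * frobCoeff lam χ (k + 1) * t ^ k)
          - 2 * ((k : ℝ) * frobCoeff lam χ k * t ^ k)
          + (χ - 4 * π ^ 2 * lam ^ 4) * (frobCoeff lam χ k * t ^ k)
          + 8 * π ^ 2 * lam ^ 3 * (frobPrev lam χ k * t ^ k)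
          - 4 * π ^ 2 * lam ^ 2 * (frobPrev₂ lam χ k * t ^ k)) = fun _ ↦ 0 := by
      funext k
      have hk := key k
      calc _ = (2 * lam * (((k : ℝ) + 1) * ((k : ℝ) * frobCoeff lam χ (k + 1)))
            - (k : ℝ) * ((k : ℝ) - 1) * frobCoeff lam χ k
            + 2 * lam * (((k : ℝ) + 1) * frobCoeff lam χ (k + 1))
            - 2 * ((k : ℝ) * frobCoeff lam χ k)
            + (χ - 4 * π ^ 2 * lam ^ 4) * frobCoeff lam χ k
            + 8 * π ^ 2 * lam ^ 3 * frobPrev lam χ k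
            - 4 * π ^ 2 * lam ^ 2 * frobPrev₂ lam χ k) * t ^ k := by ring
        _ = 0 := by rw [hk, zero_mul]
    rw [hz]
    exact hasSum_zero
  have hV := H.unique H'
  rw [e5, e4, e3, e2, e1] at hV
  linear_combination hV

/-- **The prolate equation in divergence form** for the Frobenius solution:
`−((λ² − x²) u′)′(x) + (2πλx)² u(x) = χ u(x)` for `|λ − x| < 2λ`.
[cite: SlepianPollak1961, §III eq. (11); ConnesConsaniMoscovici2025, §7 eq. (7.5)] -/
theorem frobSol_eigen (hlam : 0 < lam) (χ : ℝ) {x : ℝ} (hx : |lam - x| < 2 * lam) :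
    -(deriv (fun y ↦ (lam ^ 2 - y ^ 2) * deriv (frobSol lam χ) y) x)
      + (2 * π * lam * x) ^ 2 * frobSol lam χ x = χ * frobSol lam χ x := by
  have hopen : IsOpen {y : ℝ | |lam - y| < 2 * lam} :=
    isOpen_lt (continuous_const.sub continuous_id).abs continuous_const
  have hd1 : deriv (frobSol lam χ) =ᶠ[𝓝 x] frobSol₁ lam χ := by
    filter_upwards [hopen.mem_nhds hx] with y hy using (hasDerivAt_frobSol hlam χ hy).deriv
  have hp : HasDerivAt (fun y : ℝ ↦ lam ^ 2 - y ^ 2) (-(2 * x)) x := by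
    simpa using (hasDerivAt_pow 2 x).const_sub (lam ^ 2)
  have h1 : HasDerivAt (fun y ↦ (lam ^ 2 - y ^ 2) * frobSol₁ lam χ y)
      (-(2 * x) * frobSol₁ lam χ x + (lam ^ 2 - x ^ 2) * frobSol₂ lam χ x) x :=
    hp.mul (hasDerivAt_frobSol₁ hlam χ hx)
  have h2 : deriv (fun y ↦ (lam ^ 2 - y ^ 2) * deriv (frobSol lam χ) y) x
      = -(2 * x) * frobSol₁ lam χ x + (lam ^ 2 - x ^ 2) * frobSol₂ lam χ x := by
    rw [← h1.deriv]
    refine Filter.EventuallyEq.deriv_eq ?_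
    filter_upwards [hd1] with y hy
    rw [hy]
  rw [h2]
  linear_combination (-1 : ℝ) * frobSol_ode hlam χ hx

/-! ### Joint continuity in `(χ, x)` -/

/-- `(χ, x) ↦ u_χ(x)` is continuous on `[−M, M] × [λ − ρ, λ + ρ]` for `ρ < 2λ`.
[cite: CoddingtonLevinson1955, Ch. 4 §8] -/
theorem continuousOn_frobSol_uncurry (hlam : 0 < lam) {ρ : ℝ} (hρ0 : 0 ≤ ρ) (hρ : ρ < 2 * lam)
    (M : ℝ) : ContinuousOn (fun p : ℝ × ℝ ↦ frobSol lam p.1 p.2)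
      (Icc (-M) M ×ˢ Icc (lam - ρ) (lam + ρ)) := by
  obtain ⟨u, hu, hb⟩ := frobCoeff_majorant hlam hρ0 hρ M 0 0
  have hc := continuousOn_tsum_mul_pow (c := fun k χ ↦ frobCoeff lam χ k) (S := Icc (-M) M) hu
    (fun k ↦ (continuous_frobCoeff lam k).continuousOn)
    (fun χ hχ k ↦ by simpa using hb χ (abs_le.mpr ⟨hχ.1, hχ.2⟩) k)
  have hmap : MapsTo (fun p : ℝ × ℝ ↦ (p.1, lam - p.2)) (Icc (-M) M ×ˢ Icc (lam - ρ) (lam + ρ))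
      (Icc (-M) M ×ˢ Icc (-ρ) ρ) := by
    intro p hp
    obtain ⟨h1, h2⟩ := mem_prod.mp hp
    exact mem_prod.mpr ⟨h1, ⟨by linarith [h2.2], by linarith [h2.1]⟩⟩
  have hφ : Continuous fun p : ℝ × ℝ ↦ (p.1, lam - p.2) := by fun_prop
  exact hc.comp hφ.continuousOn hmap

/-- `(χ, x) ↦ u_χ′(x)` is continuous on `[−M, M] × [λ − ρ, λ + ρ]` for `ρ < 2λ`.
[cite: CoddingtonLevinson1955, Ch. 4 §8] -/
theorem continuousOn_frobSol₁_uncurry (hlam : 0 < lam) {ρ : ℝ} (hρ0 : 0 ≤ ρ) (hρ : ρ < 2 * lam)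
    (M : ℝ) : ContinuousOn (fun p : ℝ × ℝ ↦ frobSol₁ lam p.1 p.2)
      (Icc (-M) M ×ˢ Icc (lam - ρ) (lam + ρ)) := by
  obtain ⟨u, hu, hb⟩ := frobCoeff_majorant hlam hρ0 hρ M 1 1
  have hc := continuousOn_tsum_mul_pow
    (c := fun k χ ↦ ((k : ℝ) + 1) * frobCoeff lam χ (k + 1)) (S := Icc (-M) M) hu
    (fun k ↦ (continuous_const.mul (continuous_frobCoeff lam (k + 1))).continuousOn)
    (fun χ hχ k ↦ by
      show |((k : ℝ) + 1) * frobCoeff lam χ (k + 1)| * ρ ^ k ≤ u k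
      have h := hb χ (abs_le.mpr ⟨hχ.1, hχ.2⟩) k
      rw [pow_one] at h
      rwa [abs_mul, abs_of_nonneg (by positivity : (0 : ℝ) ≤ (k : ℝ) + 1)])
  have hmap : MapsTo (fun p : ℝ × ℝ ↦ (p.1, lam - p.2)) (Icc (-M) M ×ˢ Icc (lam - ρ) (lam + ρ))
      (Icc (-M) M ×ˢ Icc (-ρ) ρ) := by
    intro p hp
    obtain ⟨h1, h2⟩ := mem_prod.mp hp
    exact mem_prod.mpr ⟨h1, ⟨by linarith [h2.2], by linarith [h2.1]⟩⟩
  have hφ : Continuous fun p : ℝ × ℝ ↦ (p.1, lam - p.2) := by fun_prop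
  exact ((hc.comp hφ.continuousOn hmap).neg).congr fun p _ ↦ rfl

end Literature.NumberTheory.LFunctions
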